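import Summits.RiemannHypothesis.RiemannHypothesis.Theorems.HandoffWindow
import Literature.NumberTheory.LFunctions.WeilMarkovQuadratic
import Literature.NumberTheory.LFunctions.WeilWindowSuzukiAsymptoticProofs
import HarnessLib

/-!
# HANDOFF, the POSITION FACE on a window: Bombieri's archimedean integral cut at the support, with the `log coth` boundary term (cell rh-explicit, TRACK «HANDOFF», seat theory-2)

HONEST FRAMING. Nothing here proves or approaches RH. This file types, verbatim, the finite-range «position face» of the
(semilocal) Weil form that the cell's numerical engines implement (fsm_eig / ktc_zeta, ktz2l / s2fast, cc6, pub-weilobs,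
and the seat's independent `weilform_xcheck.py`, HANDOFF-STATEMENT.md §H.1 (i) / §H.10): for a Weil test function `g`
supported in `[−a, a]`, `a > 0`, with `k = g ⋆ g̃` (so `k = 0` off `(−2a, 2a)` and `k(0) = ‖g‖₂²`),

  `Re Q_S(g) = P(g) − Re Σ_n Λ_S(n) n^{−1/2}(k(log n) + k(−log n))
               − (log 4π + γ − log coth a)·‖g‖₂² − Re ∫₀^{2a} (e^{x/2}(k(x) + k(−x)) − 2k(0)) dx/(2 sinh x)`,

`log coth a = log((e^{2a} + 1)/(e^{2a} − 1)) = −(log sinh a − log cosh a)`: Bombieri's `∫₀^∞` (tree `weilArchTermBombieri`,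
equal to the digamma form by `weilArchTermBombieri_eq_weilArchTerm_holds`) is cut at `x = 2a`, beyond which only `−2k(0)/(2 sinh x)`
survives and integrates to `k(0)·(log sinh a − log cosh a)` (tree `integral_Ioi_inv_two_sinh`). Stated for EVERY finite set of
primes `S` (`weilSemilocalQuadratic S`), hence for the deficit functional `deficit_q = −Re Q_{S_q}` of the file of record
`HandoffWindow.lean` (`deficit_eq_positionFace`). Everything is assembly of tree lemmas; NO new definitions.

References: E. Bombieri, Rend. Mat. Acc. Lincei (9) 11 (2000), Thm 2 (p. 193) and the display before Thm 12 (p. 226)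
(`Bombieri2000Weil`); A. Connes, C. Consani, Enseign. Math. 69 (2023) §2.1.6 (`W_ℝ` on a window with the boundary term
`½ log((e^L + 1)/(e^L − 1))`, `L = 2a`; `ConnesConsani2023`).
-/

set_option linter.dupNamespace false  -- the mandated namespace repeats `RiemannHypothesis`

noncomputable section

open Set Filter MeasureTheory Literature.NumberTheory.LFunctions
open Summit.RiemannHypothesis.RiemannHypothesis.Theorems.Handoff
open scoped Real ComplexConjugate

namespace Summit.RiemannHypothesis.RiemannHypothesis.Theorems.HandoffPositionFace

variable {g : ℝ → ℂ} {a : ℝ}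

/-! ## §1 The boundary term: `log sinh a − log cosh a = −log coth a = −log((e^{2a}+1)/(e^{2a}−1))` -/

/-- `sinh a / cosh a = (e^{2a} − 1)/(e^{2a} + 1)`. [folklore] -/
theorem sinh_div_cosh_eq (a : ℝ) :
    Real.sinh a / Real.cosh a = (Real.exp (2 * a) - 1) / (Real.exp (2 * a) + 1) := by
  have hc : Real.cosh a ≠ 0 := (Real.cosh_pos a).ne'
  have he : 0 < Real.exp a := Real.exp_pos a
  have h2 : Real.exp (2 * a) = Real.exp a * Real.exp a := by rw [← Real.exp_add]; ring_nf
  have hinv : Real.exp (-a) * Real.exp a = 1 := by rw [← Real.exp_add]; simp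
  have hden : Real.exp (2 * a) + 1 ≠ 0 := by positivity
  rw [div_eq_div_iff hc hden, Real.sinh_eq, Real.cosh_eq, h2]
  field_simp
  nlinarith [hinv, he]

/-- **The boundary constant**: for `a > 0`, `log sinh a − log cosh a = −log((e^{2a} + 1)/(e^{2a} − 1))` (= `−log coth a`,
Connes–Consani's `−½·2·log((e^L+1)/(e^L−1))` with `L = 2a`). [cite: ConnesConsani2023, §2.1.6 (the boundary term of W_ℝ on a window)] -/
theorem log_sinh_sub_log_cosh (ha : 0 < a) :
    Real.log (Real.sinh a) - Real.log (Real.cosh a) =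
      -Real.log ((Real.exp (2 * a) + 1) / (Real.exp (2 * a) - 1)) := by
  have hs : 0 < Real.sinh a := Real.sinh_pos_iff.2 ha
  have hc : 0 < Real.cosh a := Real.cosh_pos a
  have h1 : 1 < Real.exp (2 * a) := Real.one_lt_exp_iff.2 (by linarith)
  have hm : 0 < Real.exp (2 * a) - 1 := by linarith
  have hp : 0 < Real.exp (2 * a) + 1 := by linarith
  rw [← Real.log_div hs.ne' hc.ne', sinh_div_cosh_eq, ← Real.log_inv, inv_div]

/-! ## §2 Bombieri's integral cut at the support -/

/-- Beyond the support of `k = g ⋆ g̃` (i.e. for `x > 2a` when `tsupport g ⊆ [−a, a]`) Bombieri's integrand is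
`−2k(0)/(2 sinh x) = −‖g‖₂²/sinh x`, and **the tail integrates in closed form**:
`∫_{2a}^∞ (e^{x/2}(k(x)+k(−x)) − 2k(0)) dx/(2 sinh x) = ‖g‖₂²·(log sinh a − log cosh a)`.
[cite: Bombieri2000Weil, Thm 2 (p. 193), the archimedean integral; tail by `integral_Ioi_inv_two_sinh`] -/
theorem setIntegral_Ioi_bombieri_tail (hg : IsWeilTest g) (ha : 0 < a) (hsupp : tsupport g ⊆ Icc (-a) a) :
    ∫ x in Ioi (2 * a), ((Real.exp (x / 2) : ℂ) * (weilConv g (weilReflect g) x + weilConv g (weilReflect g) (-x)) -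
        2 * weilConv g (weilReflect g) 0) / (2 * Real.sinh x : ℂ) =
      (((∫ x : ℝ, ‖g x‖ ^ 2) * (Real.log (Real.sinh a) - Real.log (Real.cosh a)) : ℝ) : ℂ) := by
  set N : ℝ := ∫ x : ℝ, ‖g x‖ ^ 2 with hN
  have hk0 : weilConv g (weilReflect g) 0 = ((N : ℝ) : ℂ) := by rw [hN]; exact weilConv_weilReflect_apply_zero g
  have hvan : ∀ x ∈ Ioi (2 * a), weilConv g (weilReflect g) x = 0 ∧ weilConv g (weilReflect g) (-x) = 0 := by
    intro x hx
    have hx' : 2 * a < x := hx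
    have h1 : 2 * a ≤ |x| := le_trans hx'.le (le_abs_self x)
    have h2 : 2 * a ≤ |(-x)| := by rw [abs_neg]; exact h1
    exact ⟨weilConv_weilReflect_eq_zero_of_le_abs hg hsupp h1, weilConv_weilReflect_eq_zero_of_le_abs hg hsupp h2⟩
  have e : ∀ x ∈ Ioi (2 * a),
      ((Real.exp (x / 2) : ℂ) * (weilConv g (weilReflect g) x + weilConv g (weilReflect g) (-x)) -
          2 * weilConv g (weilReflect g) 0) / (2 * Real.sinh x : ℂ) =
        (((-2 * N) * (1 / (2 * Real.sinh x)) : ℝ) : ℂ) := by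
    intro x hx
    rw [(hvan x hx).1, (hvan x hx).2, hk0]
    push_cast
    ring
  rw [setIntegral_congr_fun measurableSet_Ioi e, integral_complex_ofReal, integral_const_mul,
    (integral_Ioi_inv_two_sinh ha).2]
  push_cast
  ring

/-- **Bombieri's archimedean term on a window** (the finite-range position face): for `g ∈ C(a)`, `a > 0`, `k = g ⋆ g̃`,
`W_∞^{Bombieri}(k) = −(log 4π + γ + log sinh a − log cosh a)·‖g‖₂² − ∫₀^{2a} (e^{x/2}(k(x)+k(−x)) − 2k(0)) dx/(2 sinh x)`.
[cite: Bombieri2000Weil, Thm 2 (p. 193) and the display before Thm 12 (p. 226); ConnesConsani2023 §2.1.6 (boundary term)] -/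
theorem weilArchTermBombieri_window (hg : IsWeilTest g) (ha : 0 < a) (hsupp : tsupport g ⊆ Icc (-a) a) :
    weilArchTermBombieri (weilConv g (weilReflect g)) =
      -((((Real.log (4 * π) + Real.eulerMascheroniConstant + (Real.log (Real.sinh a) - Real.log (Real.cosh a))) *
            ∫ x : ℝ, ‖g x‖ ^ 2 : ℝ)) : ℂ) -
        ∫ x in Ioc 0 (2 * a), ((Real.exp (x / 2) : ℂ) *
            (weilConv g (weilReflect g) x + weilConv g (weilReflect g) (-x)) -
          2 * weilConv g (weilReflect g) 0) / (2 * Real.sinh x : ℂ) := by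
  have hk : IsWeilTest (weilConv g (weilReflect g)) := hg.weilConv hg.weilReflect
  have hF := integrableOn_bombieriIntegrand hk
  have h2a : (0 : ℝ) ≤ 2 * a := by positivity
  rw [weilArchTermBombieri_eq, ← Ioc_union_Ioi_eq_Ioi h2a,
    setIntegral_union Ioc_disjoint_Ioi_same measurableSet_Ioi (hF.mono_set Ioc_subset_Ioi_self)
      (hF.mono_set (Ioi_subset_Ioi h2a)),
    setIntegral_Ioi_bombieri_tail hg ha hsupp, weilConv_weilReflect_apply_zero]
  push_cast
  ring

/-! ## §3 The position face of `Re Q_S` and of the deficit -/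

/-- **The POSITION FACE of the semilocal Weil form on a window** (HANDOFF-STATEMENT §H.1 (i), every term): for every finite
set of primes `S`, every `a > 0` and every Weil test function `g` with `tsupport g ⊆ [−a, a]`, writing `k = g ⋆ g̃`,
`Re Q_S(g) = P(g) − Re Σ_n Λ_S(n)n^{−1/2}(k(log n)+k(−log n)) − (log 4π + γ + log sinh a − log cosh a)‖g‖₂²
             − Re ∫₀^{2a} (e^{x/2}(k(x)+k(−x)) − 2k(0)) dx/(2 sinh x)`,
with `P(g) = weilPoleForm g = 2|∫g cosh(x/2)|² − 2|∫g sinh(x/2)|²` the polar term and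
`log sinh a − log cosh a = −log((e^{2a}+1)/(e^{2a}−1))` (`log_sinh_sub_log_cosh`). `S = ∅` is the «{∞}-form», `S ⊇` all primes
`< e^{2a}` gives Weil's form on `C(a)` (locality). [cite: Bombieri2000Weil, Thm 2 (p. 193); ConnesConsani2023 §2.1.2, §2.1.6] -/
theorem re_weilSemilocalQuadratic_eq_positionFace (S : Finset ℕ) (hg : IsWeilTest g) (ha : 0 < a)
    (hsupp : tsupport g ⊆ Icc (-a) a) :
    (weilSemilocalQuadratic S g).re =
      weilPoleForm g - (weilSemilocalPrimeTerm S (weilConv g (weilReflect g))).re -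
        (Real.log (4 * π) + Real.eulerMascheroniConstant + (Real.log (Real.sinh a) - Real.log (Real.cosh a))) *
          (∫ x : ℝ, ‖g x‖ ^ 2) -
        (∫ x in Ioc 0 (2 * a), ((Real.exp (x / 2) : ℂ) *
            (weilConv g (weilReflect g) x + weilConv g (weilReflect g) (-x)) -
          2 * weilConv g (weilReflect g) 0) / (2 * Real.sinh x : ℂ)).re := by
  have hk : IsWeilTest (weilConv g (weilReflect g)) := hg.weilConv hg.weilReflect
  unfold weilSemilocalQuadratic weilSemilocalFunctional
  rw [← weilArchTermBombieri_eq_weilArchTerm_holds hk, weilArchTermBombieri_window hg ha hsupp,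
    Complex.add_re, Complex.sub_re, Complex.sub_re, Complex.neg_re, Complex.ofReal_re,
    weilPolarTerm_weilConv_weilReflect_re hg]
  ring

/-- **The deficit functional in position form**: for a prime-set `S_q = {p < q}`, `a > 0` and `g ∈ C(a)`,
`deficit_q(g) = −P(g) + Re Σ_n Λ_{S_q}(n)n^{−1/2}(k(log n)+k(−log n)) + (log 4π + γ + log sinh a − log cosh a)‖g‖₂²
              + Re ∫₀^{2a} (e^{x/2}(k(x)+k(−x)) − 2k(0)) dx/(2 sinh x)` — the exact expression the A1/A4 engines and
`weilform_xcheck.py` evaluate (HANDOFF-STATEMENT §H.1 (i), §H.10). [cite: Bombieri2000Weil, Thm 2 (p. 193); this track, file of record `deficit`] -/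
theorem deficit_eq_positionFace (q : ℕ) (hg : IsWeilTest g) (ha : 0 < a) (hsupp : tsupport g ⊆ Icc (-a) a) :
    deficit q g =
      -weilPoleForm g + (weilSemilocalPrimeTerm (Nat.primesBelow q) (weilConv g (weilReflect g))).re +
        (Real.log (4 * π) + Real.eulerMascheroniConstant + (Real.log (Real.sinh a) - Real.log (Real.cosh a))) *
          (∫ x : ℝ, ‖g x‖ ^ 2) +
        (∫ x in Ioc 0 (2 * a), ((Real.exp (x / 2) : ℂ) *
            (weilConv g (weilReflect g) x + weilConv g (weilReflect g) (-x)) -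
          2 * weilConv g (weilReflect g) 0) / (2 * Real.sinh x : ℂ)).re := by
  unfold deficit
  rw [re_weilSemilocalQuadratic_eq_positionFace _ hg ha hsupp]
  ring

/-- The prime term on a window is the FINITE sum over the visible `S`-smooth prime powers: for
`tsupport g ⊆ [−(log (N+1))/2, (log (N+1))/2]`,
`Σ_n Λ_S(n)n^{−1/2}(k(log n)+k(−log n)) = Σ_{n ≤ N} Λ_S(n)n^{−1/2}(k(log n)+k(−log n))` — every power `p^m ≤ N` of every
`p ∈ S` included (the honesty clause of §A.2/§H.1). [cite: ConnesConsani2023, Prop. 2.1 (the sum over 1 < n ≤ λ²)] -/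
theorem weilSemilocalPrimeTerm_window (S : Finset ℕ) (hg : IsWeilTest g) (N : ℕ)
    (hsupp : tsupport g ⊆ Icc (-(Real.log ((N : ℝ) + 1) / 2)) (Real.log ((N : ℝ) + 1) / 2)) :
    weilSemilocalPrimeTerm S (weilConv g (weilReflect g)) =
      ∑ n ∈ Finset.range (N + 1), (weilSemilocalCoeff S n : ℂ) *
        (weilConv g (weilReflect g) (Real.log n) + weilConv g (weilReflect g) (-Real.log n)) := by
  have hk : IsWeilTest (weilConv g (weilReflect g)) := hg.weilConv hg.weilReflect
  refine weilSemilocalPrimeTerm_eq_sum_of_tsupport_subset S hk.1.continuous N ?_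
  have h := tsupport_weilConv_weilReflect_subset (a := Real.log ((N : ℝ) + 1) / 2) hg.2 hsupp
  rwa [show 2 * (Real.log ((N : ℝ) + 1) / 2) = Real.log ((N : ℝ) + 1) by ring] at h

end Summit.RiemannHypothesis.RiemannHypothesis.Theorems.HandoffPositionFace

end
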